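import Summits.AtomisticToContinuum.HydrodynamicLimit.Theorems.JParityClosureEvenStressEnskogVelocityTailCollisionSumRung0
import Summits.AtomisticToContinuum.HydrodynamicLimit.Theorems.JParityClosureEvenStressEnskogVelocityTailEnergyRung0
import Summits.AtomisticToContinuum.HydrodynamicLimit.Theorems.InformationPercolationEngineCollisionRate
import Summits.AtomisticToContinuum.HydrodynamicLimit.Theorems.InformationPercolationEngineCollisionRateTubeRegular
import HarnessLib

/-!
# R1 at rung 0: velocity truncation of the UNIT-mark collision statistic under the homogeneous Gibbs law
# (`stub_unitMarkTruncationRung0`, line `Sketch`, crux `InformationPercolationEngine.CollisionRate`,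
# stmt-AtomisticToContinuum-13481)

The crux `CollisionRate` is the even collision statistic `evenStat σ N Φ τ χ g Ξ r` at the constant mark
`Ξ ≡ 1` (`collisionRate_iff_evenStat_one`); its rung-0 chassis (constant profiles: the local Gibbs law is
the flow-invariant homogeneous Gibbs law) runs on the SPEED-TRUNCATED unit mark
`Ξ₁ᴸ(n̂, v, w) = ψ_L(‖w − v‖)` (`speedCutoff`).  The registered stub R1 proved here is the mark-`1` twin of
the sibling's S1|const (`EvenStressEnskog.stub_velocityTruncationRung0`, crux stmt-13079): replacing `1`
by `Ξ₁ᴸ` changes `evenStat` by more than `η` only on an event of probability `≤ δ` (`L ≥ L₀(r, …)`,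
`N ≥ N₀`).  Proof = the finite-`N` core of `Literature/…/EvenStatTruncationBound` ported to the pair
`(1, Ξ₁ᴸ)`, `L ≥ 1`: collision side `|1 − ψ_L(‖w − v‖)| ≤ m_L = ‖w − v‖(1 − ψ_L(‖w − v‖))`
(`speedTailMark`: both sides vanish for `‖w − v‖ ≤ L`, and `‖w − v‖ > L ≥ 1` otherwise), whence
`|K_N[χ g 1] − K_N[χ g Ξ₁ᴸ]| ≤ C_χ K_N[1·|g|·m_L]` pathwise; Enskog side `Θ 1 − Θ Ξ₁ᴸ = π m_L` EXACTLY
(`sphereMark_const_one`, `sphereMark_speedCutoff`, `ν(u) = π‖u‖`) `≤ π‖w − v‖²(1 − ψ_L) ≤ π(4t_L(v) +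
4t_L(w))`, whence `|e(1) − e(Ξ₁ᴸ)| ≤ C_χ C_{gY}(3/πr³)² 8π T_L` (`T_L = tailEnergy L`) and its time
integral along good orbits; the union bound off the null bad set; then — verbatim the sibling's
`velocityTruncation_of_tails_at` at constant profiles — the rung-0 inputs (H_K)₀
`EvenStressEnskog.stub_velocityTailCollisionSumRung0` and (H_E)₀
`EvenStressEnskog.stub_velocityTailEnergyRung0` (Markov + Tonelli, `measure_lt_setIntegral_flow_le`),
with the contact-value band of `EvenStressEnskog.exists_bound_mul_contactValue` (`|g·Y| ≤ C_{gY}`).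

References: H. Spohn, *Large Scale Dynamics of Interacting Particles* (1991), Part I §2–3;
Chapman–Cowling (1970) Ch. 16; C. Cercignani, R. Illner, M. Pulvirenti (1994) §3.1, §4.2.
-/

noncomputable section

open MeasureTheory Set Filter Topology
open scoped ENNReal InnerProductSpace BigOperators

namespace Summit.AtomisticToContinuum.HydrodynamicLimit.Theorems.CollisionRate

open Literature.Analysis.FluidPDE Literature.MathematicalPhysics.KineticTheory
open Summit.AtomisticToContinuum.HydrodynamicLimit.Theorems.EvenStressEnskog
  (stub_velocityTailCollisionSumRung0 stub_velocityTailEnergyRung0 exists_bound_mul_contactValue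
    measure_lt_setIntegral_flow_le)

/-! ## One configuration: the truncation error of the unit mark -/

/-- For `1 ≤ L`: `|1 − ψ_L(‖w − v‖)| ≤ m_L(n, v, w) = ‖w − v‖(1 − ψ_L(‖w − v‖))` — both sides vanish
for `‖w − v‖ ≤ L`, and `1 ≤ L < ‖w − v‖` otherwise. [folklore] -/
theorem abs_one_sub_speedCutoff_le_speedTailMark {L : ℝ} (hL : 1 ≤ L) (q : V3 × V3 × V3) :
    |1 - speedCutoff L ‖q.2.2 - q.2.1‖| ≤ speedTailMark L q := by
  have hψ := speedCutoff_mem_Icc L ‖q.2.2 - q.2.1‖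
  rw [abs_of_nonneg (sub_nonneg.2 hψ.2)]
  unfold speedTailMark
  by_cases h : ‖q.2.2 - q.2.1‖ ≤ L
  · rw [speedCutoff_eq_one (one_pos.trans_le hL) h, sub_self, mul_zero]
  · push Not at h
    exact le_mul_of_one_le_left (sub_nonneg.2 hψ.2) (hL.trans h.le)

/-- **The sphere-integrated truncation error of the unit mark** (`1 ≤ L`):
`Θ 1 (v, w) − Θ Ξ₁ᴸ (v, w) = π‖w − v‖(1 − ψ_L(‖w − v‖))` exactly (`Θ 1 = π‖v − w‖`,
`Θ Ξ₁ᴸ = ψ_L ν(w − v)`, `ν(u) = π‖u‖`), hence `≤ π‖w − v‖²(1 − ψ_L) ≤ π(4 t_L(v) + 4 t_L(w))`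
(`t_L = velTail L`, `sq_mul_one_sub_speedCutoff_le`). [folklore] -/
theorem abs_sphereMark_one_sub_le {L : ℝ} (hL : 1 ≤ L) (v w : V3) :
    |sphereMark (fun _ => (1 : ℝ)) v w
        - sphereMark (fun q : V3 × V3 × V3 => speedCutoff L ‖q.2.2 - q.2.1‖) v w|
      ≤ Real.pi * (4 * velTail L v + 4 * velTail L w) := by
  have hL0 : 0 < L := one_pos.trans_le hL
  have hψ := speedCutoff_mem_Icc L ‖w - v‖
  have heq : sphereMark (fun _ => (1 : ℝ)) v w
      - sphereMark (fun q : V3 × V3 × V3 => speedCutoff L ‖q.2.2 - q.2.1‖) v w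
      = Real.pi * (‖w - v‖ * (1 - speedCutoff L ‖w - v‖)) := by
    rw [sphereMark_const_one, sphereMark_speedCutoff, lorentzLossRate_eq_pi_mul_norm, norm_sub_rev v w]
    ring
  rw [heq, abs_mul, abs_of_pos Real.pi_pos, abs_of_nonneg (mul_nonneg (norm_nonneg _) (sub_nonneg.2 hψ.2))]
  refine mul_le_mul_of_nonneg_left (le_trans ?_ (sq_mul_one_sub_speedCutoff_le hL0 v w)) Real.pi_pos.le
  by_cases h : ‖w - v‖ ≤ L
  · rw [speedCutoff_eq_one hL0 h, sub_self, mul_zero, mul_zero]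
  · push Not at h
    have h1 : 1 ≤ ‖w - v‖ := hL.trans h.le
    refine mul_le_mul_of_nonneg_right ?_ (sub_nonneg.2 hψ.2)
    nlinarith

/-- Quadratic-growth bound of `Θ 1`: `|Θ 1 (v, w)| = π‖v − w‖ ≤ π + π(‖v‖² + ‖w‖²)`. [folklore] -/
theorem abs_sphereMark_one_le' (v w : V3) :
    |sphereMark (fun _ => (1 : ℝ)) v w| ≤ Real.pi + Real.pi * (‖v‖ ^ 2 + ‖w‖ ^ 2) := by
  rw [sphereMark_const_one, abs_of_nonneg (by positivity)]
  have h2 : ‖v - w‖ ≤ 1 + (‖v‖ ^ 2 + ‖w‖ ^ 2) := by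
    nlinarith [norm_sub_le v w, sq_nonneg (‖v‖ - 1 / 2), sq_nonneg (‖w‖ - 1 / 2)]
  nlinarith [Real.pi_pos]

/-- Growth bound of `Θ Ξ₁ᴸ` in quadratic form (`0 < L`): `|Θ Ξ₁ᴸ (v, w)| ≤ 2L|S²| + 0·(‖v‖² + ‖w‖²)`.
[folklore] -/
theorem abs_sphereMark_speedCutoff_le' {L : ℝ} (hL : 0 < L) (v w : V3) :
    |sphereMark (fun q : V3 × V3 × V3 => speedCutoff L ‖q.2.2 - q.2.1‖) v w|
      ≤ 2 * L * sphereMass V3 + 0 * (‖v‖ ^ 2 + ‖w‖ ^ 2) := by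
  rw [zero_mul, add_zero]
  exact abs_sphereMark_speedCutoff_le hL v w

/-- **Truncation error of the pair functional at the unit mark** (`1 ≤ L`, `0 < r`):
`|B_r 1 (z, x) − B_r Ξ₁ᴸ (z, x)| ≤ (3/πr³)²·8π·T_L(z)` (double sum of cone weights `∈ [0, 3/πr³]` times
`abs_sphereMark_one_sub_le`). [folklore] -/
theorem abs_pairFunctional_one_sub_le {N : ℕ} {L r : ℝ} (hL : 1 ≤ L) (hr : 0 < r)
    (z : Config (N + 1) (Fin 3) T3) (x : UnitAddTorus (Fin 3)) :
    |pairFunctional r (fun _ => (1 : ℝ)) z x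
        - pairFunctional r (fun q : V3 × V3 × V3 => speedCutoff L ‖q.2.2 - q.2.1‖) z x|
      ≤ (3 / (Real.pi * r ^ 3)) ^ 2 * (8 * Real.pi) * tailEnergy L z := by
  have hM0 : 0 ≤ 3 / (Real.pi * r ^ 3) := by positivity
  have hn : (0 : ℝ) < ((N + 1 : ℕ) : ℝ) := by exact_mod_cast Nat.succ_pos N
  rw [pairFunctional_eq_double_sum, pairFunctional_eq_double_sum, ← mul_sub, abs_mul,
    abs_of_nonneg (by positivity : (0 : ℝ) ≤ ((N + 1 : ℕ) : ℝ)⁻¹ * ((N + 1 : ℕ) : ℝ)⁻¹)]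
  have hterm : ∀ i j : Fin (N + 1),
      |coneKernel r (z i).1 x * coneKernel r (z j).1 x * sphereMark (fun _ => (1 : ℝ)) (z i).2 (z j).2 -
        coneKernel r (z i).1 x * coneKernel r (z j).1 x *
          sphereMark (fun q : V3 × V3 × V3 => speedCutoff L ‖q.2.2 - q.2.1‖) (z i).2 (z j).2|
      ≤ (3 / (Real.pi * r ^ 3)) ^ 2 * Real.pi * 4 * (velTail L (z i).2 + velTail L (z j).2) := by
    intro i j
    have hbi : 0 ≤ coneKernel r (z i).1 x ∧ coneKernel r (z i).1 x ≤ 3 / (Real.pi * r ^ 3) :=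
      coneKernel_nonneg_le hr (z i).1 x
    have hbj : 0 ≤ coneKernel r (z j).1 x ∧ coneKernel r (z j).1 x ≤ 3 / (Real.pi * r ^ 3) :=
      coneKernel_nonneg_le hr (z j).1 x
    rw [← mul_sub, abs_mul, abs_of_nonneg (mul_nonneg hbi.1 hbj.1)]
    calc _ ≤ (3 / (Real.pi * r ^ 3) * (3 / (Real.pi * r ^ 3))) *
            (Real.pi * (4 * velTail L (z i).2 + 4 * velTail L (z j).2)) :=
          mul_le_mul (mul_le_mul hbi.2 hbj.2 hbj.1 hM0) (abs_sphereMark_one_sub_le hL _ _) (abs_nonneg _)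
            (mul_nonneg hM0 hM0)
      _ = _ := by ring
  have hsum := abs_sum_sum_sub_le_of_le hterm
  calc _ ≤ ((N + 1 : ℕ) : ℝ)⁻¹ * ((N + 1 : ℕ) : ℝ)⁻¹ * ((3 / (Real.pi * r ^ 3)) ^ 2 * Real.pi * 4 *
          (2 * ((N + 1 : ℕ) : ℝ) * ∑ i, velTail L (z i).2)) := by
        refine mul_le_mul_of_nonneg_left ?_ (by positivity)
        simpa only [Fintype.card_fin] using hsum
    _ = (3 / (Real.pi * r ^ 3)) ^ 2 * (8 * Real.pi) * tailEnergy L z := by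
        unfold tailEnergy
        field_simp
        ring

/-- **Truncation error of the Enskog rate functional at the unit mark** of one configuration (`1 ≤ L`):
`|e_t(1)(z) − e_t(Ξ₁ᴸ)(z)| ≤ C_χ C_{gY}(3/πr³)² 8π · T_L(z)` (`|χ(t, ·)| ≤ C_χ`, `|g·Y| ≤ C_{gY}` on
`[0, ∞)`; both `𝕋³`-integrands are integrable, `integrable_enskogIntegrand`). [folklore] -/
theorem abs_enskogRate_one_sub_le {σ : ℝ} {N : ℕ} {χ : ℝ × UnitAddTorus (Fin 3) → ℝ} {g : ℝ → ℝ}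
    (hχ : Continuous χ) (hg : Continuous g) {t Cχ CgY : ℝ} (hχb : ∀ x, |χ (t, x)| ≤ Cχ)
    (hgY : ∀ a, 0 ≤ a → |g a * contactValue a| ≤ CgY) (hσ : 0 ≤ σ) {r L : ℝ} (hr : 0 < r) (hL : 1 ≤ L)
    (z : Config (N + 1) (Fin 3) T3) :
    |enskogRate σ N χ g (fun _ => (1 : ℝ)) r t z
        - enskogRate σ N χ g (fun q : V3 × V3 × V3 => speedCutoff L ‖q.2.2 - q.2.1‖) r t z|
      ≤ Cχ * CgY * ((3 / (Real.pi * r ^ 3)) ^ 2 * (8 * Real.pi)) * tailEnergy L z := by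
  have hL0 : 0 < L := one_pos.trans_le hL
  have hCχ0 : 0 ≤ Cχ := (abs_nonneg _).trans (hχb (z 0).1)
  have hCgY0 : 0 ≤ CgY := (abs_nonneg _).trans (hgY 0 le_rfl)
  unfold enskogRate
  rw [← integral_sub
    (integrable_enskogIntegrand hχ hg hgY hσ hr (continuous_sphereMark_uncurry continuous_const).measurable
      abs_sphereMark_one_le' t z)
    (integrable_enskogIntegrand hχ hg hgY hσ hr
      (continuous_sphereMark_uncurry (continuous_speedCutoff_mark L)).measurable
      (abs_sphereMark_speedCutoff_le' hL0) t z)]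
  have hb : ∀ x : UnitAddTorus (Fin 3),
      ‖χ (t, x) * g (σ ^ 3 * mollDensity r z x) * contactValue (σ ^ 3 * mollDensity r z x) *
          pairFunctional r (fun _ => (1 : ℝ)) z x -
        χ (t, x) * g (σ ^ 3 * mollDensity r z x) * contactValue (σ ^ 3 * mollDensity r z x) *
          pairFunctional r (fun q : V3 × V3 × V3 => speedCutoff L ‖q.2.2 - q.2.1‖) z x‖
      ≤ Cχ * CgY * ((3 / (Real.pi * r ^ 3)) ^ 2 * (8 * Real.pi)) * tailEnergy L z := by
    intro x
    have ha : 0 ≤ σ ^ 3 * mollDensity r z x :=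
      mul_nonneg (pow_nonneg hσ 3) (mollDensity_nonneg_of_pos hr z x)
    rw [← mul_sub, Real.norm_eq_abs, show χ (t, x) * g (σ ^ 3 * mollDensity r z x) *
      contactValue (σ ^ 3 * mollDensity r z x) = χ (t, x) * (g (σ ^ 3 * mollDensity r z x) *
        contactValue (σ ^ 3 * mollDensity r z x)) by ring, abs_mul, abs_mul, mul_assoc (Cχ * CgY)]
    exact mul_le_mul (mul_le_mul (hχb x) (hgY _ ha) (abs_nonneg _) hCχ0)
      (abs_pairFunctional_one_sub_le hL hr z x) (abs_nonneg _) (mul_nonneg hCχ0 hCgY0)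
  have h := norm_integral_le_of_norm_le_const (μ := volume) (ae_of_all _ hb)
  rwa [Real.norm_eq_abs, show (volume : Measure (UnitAddTorus (Fin 3))).real univ = 1 from probReal_univ,
    mul_one] at h

/-! ## Along good orbits -/

/-- **The pathwise truncation error of the Enskog term at the unit mark** along a good orbit (`1 ≤ L`):
`|∫₀^τ e_s(1)(Φ_s z) ds − ∫₀^τ e_s(Ξ₁ᴸ)(Φ_s z) ds| ≤ C_χ C_{gY}(3/πr³)² 8π ∫₀^τ T_L(Φ_s z) ds` (both
time integrals are honest, `integrableOn_enskogRate_flow`). [folklore] -/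
theorem abs_setIntegral_enskogRate_one_sub_le {σ : ℝ} {N : ℕ}
    (Φ : HardSphereFlow (Torus.geometry (Fin 3)) (hsDiameter σ N) (N + 1))
    {z : Config (N + 1) (Fin 3) T3} (hz : z ∈ Φ.good) {χ : ℝ × UnitAddTorus (Fin 3) → ℝ} {g : ℝ → ℝ}
    (hχ : Continuous χ) (hg : Continuous g) {τ Cχ CgY : ℝ}
    (hχb : ∀ s ∈ Icc (0 : ℝ) τ, ∀ x, |χ (s, x)| ≤ Cχ) (hgY : ∀ a, 0 ≤ a → |g a * contactValue a| ≤ CgY)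
    (hσ : 0 ≤ σ) {r L : ℝ} (hr : 0 < r) (hL : 1 ≤ L) :
    |(∫ s in Icc (0 : ℝ) τ, enskogRate σ N χ g (fun _ => (1 : ℝ)) r s (Φ.flow s z)) -
        ∫ s in Icc (0 : ℝ) τ,
          enskogRate σ N χ g (fun q : V3 × V3 × V3 => speedCutoff L ‖q.2.2 - q.2.1‖) r s (Φ.flow s z)|
      ≤ Cχ * CgY * ((3 / (Real.pi * r ^ 3)) ^ 2 * (8 * Real.pi)) *
          ∫ s in Icc (0 : ℝ) τ, tailEnergy L (Φ.flow s z) := by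
  have hL0 : 0 < L := one_pos.trans_le hL
  have hIP := integrableOn_enskogRate_flow Φ hz hχ hg hχb hgY hσ hr
    (continuous_sphereMark_uncurry continuous_const).measurable abs_sphereMark_one_le'
  have hIL := integrableOn_enskogRate_flow Φ hz hχ hg hχb hgY hσ hr
    (continuous_sphereMark_uncurry (continuous_speedCutoff_mark L)).measurable
    (abs_sphereMark_speedCutoff_le' hL0)
  have hIT := integrableOn_tailEnergy_flow Φ hz L τ
  rw [← integral_sub hIP hIL]
  refine abs_integral_le_integral_abs.trans (le_of_le_of_eq ?_ (integral_const_mul _ _))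
  refine setIntegral_mono_on (hIP.sub hIL).abs (hIT.const_mul _) measurableSet_Icc fun s hs => ?_
  exact abs_enskogRate_one_sub_le hχ hg (hχb s hs) hgY hσ hr hL _

/-- **The pathwise truncation error of the collision sum at the unit mark.**  Along an orbit with finitely
many collision times in `[0, τ]` (every good orbit), for `1 ≤ L`:
`|K_N[χ g 1] − K_N[χ g Ξ₁ᴸ]| ≤ C_χ K_N[1·|g|·m_L]` (`abs_one_sub_speedCutoff_le_speedTailMark` termwise).
[folklore] -/
theorem abs_collisionSum_one_sub_le {σ : ℝ} {N : ℕ}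
    (Φ : HardSphereFlow (Torus.geometry (Fin 3)) (hsDiameter σ N) (N + 1)) {τ : ℝ}
    {χ : ℝ × UnitAddTorus (Fin 3) → ℝ} (g : ℝ → ℝ) (r : ℝ) {L Cχ : ℝ} (hσ : 0 < σ) (hL : 1 ≤ L)
    (hχb : ∀ s ∈ Icc (0 : ℝ) τ, ∀ x, |χ (s, x)| ≤ Cχ) {z : Config (N + 1) (Fin 3) T3}
    (hfin : (collisionTimes (Torus.geometry (Fin 3)) (hsDiameter σ N) (fun s => Φ.flow s z) ∩
      Icc 0 τ).Finite) :
    |collisionSum σ N Φ τ χ g (fun _ => (1 : ℝ)) r z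
        - collisionSum σ N Φ τ χ g (fun q : V3 × V3 × V3 => speedCutoff L ‖q.2.2 - q.2.1‖) r z|
      ≤ Cχ * collisionSum σ N Φ τ (fun _ => 1) (fun a => |g a|) (speedTailMark L) r z := by
  have hε := hsDiameter_pos hσ N
  have hc0 : 0 ≤ hsDiameter σ N / (N + 1 : ℝ) := div_nonneg hε.le (by positivity)
  dsimp only [Literature.MathematicalPhysics.KineticTheory.collisionSum]
  simp_rw [finsum_mem_eq_finite_toFinset_sum _ hfin]
  rw [← mul_sub, abs_mul, abs_of_nonneg hc0, mul_left_comm]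
  refine mul_le_mul_of_nonneg_left ?_ hc0
  rw [← Finset.sum_sub_distrib, Finset.mul_sum]
  refine (Finset.abs_sum_le_sum_abs _ _).trans (Finset.sum_le_sum fun s hs => ?_)
  have hsI : s ∈ Icc (0 : ℝ) τ := ((Set.Finite.mem_toFinset hfin).1 hs).2
  rw [← Finset.sum_sub_distrib, Finset.mul_sum]
  refine (Finset.abs_sum_le_sum_abs _ _).trans (Finset.sum_le_sum fun i _ => ?_)
  rw [← Finset.sum_sub_distrib, Finset.mul_sum]
  refine (Finset.abs_sum_le_sum_abs _ _).trans (Finset.sum_le_sum fun j _ => ?_)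
  split_ifs with hcond
  · exact abs_mul_mul_sub_le_aux (hχb s hsI _) (abs_one_sub_speedCutoff_le_speedTailMark hL (_, _, _))
  · simp

/-! ## The union bound for one particle number -/

/-- **The truncation event is covered by the two tail events** (one particle number, one flow).  For
`P = localGibbsLaw …`, `σ, r > 0`, `L ≥ 1`, continuous `χ, g` with `|χ| ≤ C_χ` on `[0, τ] × 𝕋³` and
`|g·Y| ≤ C_{gY}` on `[0, ∞)`:
`P{η < |D(1) − D(Ξ₁ᴸ)|} ≤ P{η/2 < C_χ K_N[1, |g|, m_L]} + P{η/2 < σ³ C_E ∫₀^τ T_L(Φ_s ·) ds}`,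
`C_E = C_χ C_{gY}(3/πr³)² 8π` — off the null bad set, `abs_collisionSum_one_sub_le` and
`abs_setIntegral_enskogRate_one_sub_le`. [folklore] -/
theorem measure_lt_abs_evenStat_one_sub_le {σ : ℝ} {a₀ θ₀ : T3 → ℝ} {u₀ : T3 → V3} {N : ℕ}
    (Φ : HardSphereFlow (Torus.geometry (Fin 3)) (hsDiameter σ N) (N + 1)) {τ : ℝ}
    {χ : ℝ × UnitAddTorus (Fin 3) → ℝ} {g : ℝ → ℝ} (hχ : Continuous χ) (hg : Continuous g)
    {Cχ CgY : ℝ} (hχb : ∀ s ∈ Icc (0 : ℝ) τ, ∀ x, |χ (s, x)| ≤ Cχ)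
    (hgY : ∀ a, 0 ≤ a → |g a * contactValue a| ≤ CgY) (hσ : 0 < σ) {r L : ℝ} (hr : 0 < r) (hL : 1 ≤ L)
    (η : ℝ) :
    localGibbsLaw σ a₀ u₀ θ₀ N Φ {z | η < |evenStat σ N Φ τ χ g (fun _ => (1 : ℝ)) r z
        - evenStat σ N Φ τ χ g (fun q : V3 × V3 × V3 => speedCutoff L ‖q.2.2 - q.2.1‖) r z|}
      ≤ localGibbsLaw σ a₀ u₀ θ₀ N Φ
          {z | η / 2 < Cχ * collisionSum σ N Φ τ (fun _ => 1) (fun a => |g a|) (speedTailMark L) r z} +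
        localGibbsLaw σ a₀ u₀ θ₀ N Φ
          {z | η / 2 < σ ^ 3 * (Cχ * CgY * ((3 / (Real.pi * r ^ 3)) ^ 2 * (8 * Real.pi))) *
              ∫ s in Icc (0 : ℝ) τ, tailEnergy L (Φ.flow s z)} := by
  set P := localGibbsLaw σ a₀ u₀ θ₀ N Φ with hP
  set CE := Cχ * CgY * ((3 / (Real.pi * r ^ 3)) ^ 2 * (8 * Real.pi)) with hCE
  set A := {z | η < |evenStat σ N Φ τ χ g (fun _ => (1 : ℝ)) r z
    - evenStat σ N Φ τ χ g (fun q : V3 × V3 × V3 => speedCutoff L ‖q.2.2 - q.2.1‖) r z|} with hA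
  set BK := {z | η / 2 < Cχ * collisionSum σ N Φ τ (fun _ => 1) (fun a => |g a|) (speedTailMark L) r z}
    with hBK
  set BE := {z : Config (N + 1) (Fin 3) T3 |
    η / 2 < σ ^ 3 * CE * ∫ s in Icc (0 : ℝ) τ, tailEnergy L (Φ.flow s z)} with hBE
  have hsub : A ∩ Φ.good ⊆ BK ∪ BE := by
    rintro z ⟨hz, hzg⟩
    have hK := abs_collisionSum_one_sub_le Φ g r hσ hL hχb ((Φ.isTrajectory z hzg).locFinite 0 τ)
    have hE := abs_setIntegral_enskogRate_one_sub_le Φ hzg hχ hg hχb hgY hσ.le hr hL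
    simp only [hA, hBK, hBE, mem_setOf_eq, mem_union] at hz ⊢
    by_contra hno
    push Not at hno
    obtain ⟨h1, h2⟩ := hno
    have hσ3 : 0 ≤ σ ^ 3 := by positivity
    simp only [evenStat_def] at hz
    rw [show ∀ a b c d : ℝ, a - σ ^ 3 * b - (c - σ ^ 3 * d) = (a - c) - σ ^ 3 * (b - d) from
      fun a b c d => by ring] at hz
    have h3 := (lt_of_lt_of_le hz (abs_sub _ _)).trans_le
      (add_le_add hK (le_of_eq_of_le (by rw [abs_mul, abs_of_nonneg hσ3]) (mul_le_mul_of_nonneg_left hE hσ3)))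
    linarith
  calc P A ≤ P (A ∩ Φ.good ∪ Φ.goodᶜ) := by
        refine measure_mono fun z hz => ?_
        by_cases hzg : z ∈ Φ.good
        · exact Or.inl ⟨hz, hzg⟩
        · exact Or.inr hzg
    _ ≤ P (A ∩ Φ.good) + P Φ.goodᶜ := measure_union_le _ _
    _ = P (A ∩ Φ.good) := by rw [hP, localGibbsLaw_compl_good_eq_zero, add_zero]
    _ ≤ P (BK ∪ BE) := measure_mono hsub
    _ ≤ P BK + P BE := measure_union_le _ _

/-! ## The registered stub -/

/-- **R1 · unit-mark velocity truncation at rung 0** (registered stub `stub_unitMarkTruncationRung0` of the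
line `Sketch` of crux stmt-AtomisticToContinuum-13481, verbatim).  For constant profiles `(ā, ū, θ̄)`,
`ā, θ̄ > 0`, under the homogeneous Gibbs law, replacing the unit mark by its speed truncation
`Ξ₁ᴸ = ψ_L(‖w − v‖)` changes `evenStat` by more than `η` only on an event of probability `≤ δ`, for
`L ≥ L₀(r, …)`, `N ≥ N₀`.  `η₀ = min ηK ηY` (`ηK` of (H_K)₀ `EvenStressEnskog.stub_velocityTailCollisionSumRung0`,
`ηY` the band of `EvenStressEnskog.exists_bound_mul_contactValue` on which `|g·Y| ≤ C_{gY}`); thresholds as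
in the sibling's `velocityTruncation_of_tails_at`: `σ₀ = min σK σE ½`, (H_K)₀ run with the cutoff `|g|` at
`(η/(2C_χ), δ/2)`, (H_E)₀ `EvenStressEnskog.stub_velocityTailEnergyRung0` at mean accuracy `ηδ/(4c′τ)`,
`c′ = σ³C_E + 1`, `C_E = C_χ C_{gY}(3/πr³)² 8π`, `L₀ = max L₀ᴷ L₀ᴱ 1`, `N₀ = max`; then
`measure_lt_abs_evenStat_one_sub_le` and Markov–Tonelli (`measure_lt_setIntegral_flow_le`). [folklore] -/
theorem stub_unitMarkTruncationRung0 :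
    ∃ η₀ : ℝ, 0 < η₀ ∧ ∀ (ab θb : ℝ) (ub : V3), 0 < ab → 0 < θb → ∃ σ₀ : ℝ, 0 < σ₀ ∧ ∀ σ : ℝ, 0 < σ → σ < σ₀ →
      ∀ Φ : (N : ℕ) → HardSphereFlow (Torus.geometry (Fin 3)) (hsDiameter σ N) (N + 1),
      ∀ τ : ℝ, 0 < τ → ∀ χ : ℝ × T3 → ℝ, Continuous χ → ∀ g : ℝ → ℝ, Continuous g →
      (∀ x, η₀ ≤ x → g x = 0) →
      ∀ η δ : ℝ, 0 < η → 0 < δ → ∃ r₀ : ℝ, 0 < r₀ ∧ ∀ r : ℝ, 0 < r → r < r₀ →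
      ∃ L₀ : ℝ, ∀ L : ℝ, L₀ ≤ L → ∃ N₀ : ℕ, ∀ N : ℕ, N₀ ≤ N →
        localGibbsLaw σ (fun _ => ab) (fun _ => ub) (fun _ => θb) N (Φ N)
          {z | η < |evenStat σ N (Φ N) τ χ g (fun _ => 1) r z -
              evenStat σ N (Φ N) τ χ g (fun q : V3 × V3 × V3 => speedCutoff L ‖q.2.2 - q.2.1‖) r z|}
          ≤ ENNReal.ofReal δ := by
  obtain ⟨ηK, hηK, HK0⟩ := stub_velocityTailCollisionSumRung0
  obtain ⟨ηY, hηY, hY⟩ := exists_bound_mul_contactValue hsEosLowDensity_JParityClosure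
  refine ⟨min ηK ηY, lt_min hηK hηY, fun ab θb ub hab hθb => ?_⟩
  obtain ⟨σK, hσK, HK⟩ := HK0 ab θb ub hab hθb
  obtain ⟨σE, hσE, HE⟩ := stub_velocityTailEnergyRung0 ab θb ub hab hθb
  refine ⟨min (min σK σE) (1 / 2), lt_min (lt_min hσK hσE) (by norm_num), ?_⟩
  intro σ hσ hσlt Φ τ hτ χ hχ g hg hg0 η δ hη hδ
  have hσK' : σ < σK := lt_of_lt_of_le hσlt ((min_le_left _ _).trans (min_le_left _ _))
  have hσE' : σ < σE := lt_of_lt_of_le hσlt ((min_le_left _ _).trans (min_le_right _ _))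
  have hσhalf : σ ≤ 1 / 2 := (lt_of_lt_of_le hσlt (min_le_right _ _)).le
  -- the bound of `χ` on `[0, τ] × 𝕋³` and of `g · Y` on `[0, ∞)`
  obtain ⟨Cχ', hCχ'⟩ := (isCompact_Icc.prod isCompact_univ :
    IsCompact (Icc (0 : ℝ) τ ×ˢ (univ : Set (UnitAddTorus (Fin 3))))).exists_bound_of_continuousOn
      hχ.continuousOn
  set Cχ := max Cχ' 1 with hCχdef
  have hχb : ∀ s ∈ Icc (0 : ℝ) τ, ∀ x, |χ (s, x)| ≤ Cχ := fun s hs x => by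
    have := hCχ' (s, x) ⟨hs, mem_univ _⟩
    rw [Real.norm_eq_abs] at this
    exact this.trans (le_max_left _ _)
  have hCχ0 : 0 < Cχ := one_pos.trans_le (le_max_right _ _)
  obtain ⟨CgY, hCgY0, hgY⟩ := hY g hg fun a h => hg0 a ((min_le_right _ _).trans h)
  -- the collision input (H_K)₀ with the cutoff `|g|`
  obtain ⟨r₀, hr₀, HK⟩ := HK σ hσ hσK' Φ τ hτ (fun a => |g a|) hg.abs
    (fun a h => by simp only [hg0 a ((min_le_left _ _).trans h), abs_zero]) (fun a => abs_nonneg _)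
    (η / (2 * Cχ)) (δ / 2) (by positivity) (by positivity)
  refine ⟨r₀, hr₀, fun r hr hrlt => ?_⟩
  obtain ⟨LK, HK⟩ := HK r hr hrlt
  -- the energy input (H_E)₀
  set CE := Cχ * CgY * ((3 / (Real.pi * r ^ 3)) ^ 2 * (8 * Real.pi)) with hCEdef
  have hCE0 : 0 ≤ CE := by positivity
  set c' := σ ^ 3 * CE + 1 with hc'def
  have hc'0 : 0 < c' := by positivity
  obtain ⟨LE, HE⟩ := HE σ hσ hσE' Φ τ hτ (η * δ / (4 * c' * τ)) (by positivity)
  refine ⟨max LK (max LE 1), fun L hL => ?_⟩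
  have hL1 : 1 ≤ L := ((le_max_right _ _).trans (le_max_right _ _)).trans hL
  obtain ⟨NK, HK⟩ := HK L ((le_max_left _ _).trans hL)
  obtain ⟨NE, HE⟩ := HE L (((le_max_left _ _).trans (le_max_right _ _)).trans hL)
  refine ⟨max NK NE, fun N hN => ?_⟩
  haveI hPN : IsProbabilityMeasure (localGibbsLaw σ (fun _ => ab) (fun _ => ub) (fun _ => θb) N (Φ N)) :=
    isProbabilityMeasure_localGibbsLaw (a₀ := fun _ => ab) (θ₀ := fun _ => θb) (u₀ := fun _ => ub)
      continuous_const continuous_const continuous_const (fun _ => hab) (fun _ => hθb) hσhalf N (Φ N)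
  set P := localGibbsLaw σ (fun _ => ab) (fun _ => ub) (fun _ => θb) N (Φ N) with hP
  have main := measure_lt_abs_evenStat_one_sub_le (a₀ := fun _ => ab) (θ₀ := fun _ => θb)
    (u₀ := fun _ => ub) (Φ N) hχ hg hχb hgY hσ hr hL1 η
  -- the collision event
  have hKev : P {z | η / 2 < Cχ * collisionSum σ N (Φ N) τ (fun _ => 1) (fun a => |g a|) (speedTailMark L) r z}
      ≤ ENNReal.ofReal (δ / 2) := by
    refine le_trans (measure_mono fun z hz => ?_) (HK N ((le_max_left _ _).trans hN))
    simp only [mem_setOf_eq] at hz ⊢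
    rw [div_lt_iff₀ (by positivity)]
    nlinarith
  -- the energy event
  have hEev : P {z | η / 2 < σ ^ 3 * CE * ∫ s in Icc (0 : ℝ) τ, tailEnergy L ((Φ N).flow s z)}
      ≤ ENNReal.ofReal (δ / 2) := by
    have hincl : {z | η / 2 < σ ^ 3 * CE * ∫ s in Icc (0 : ℝ) τ, tailEnergy L ((Φ N).flow s z)} ⊆
        {z | η / (2 * c') < ∫ s in Icc (0 : ℝ) τ, tailEnergy L ((Φ N).flow s z)} := by
      intro z hz
      simp only [mem_setOf_eq] at hz ⊢
      have hI : 0 ≤ ∫ s in Icc (0 : ℝ) τ, tailEnergy L ((Φ N).flow s z) :=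
        setIntegral_nonneg measurableSet_Icc fun s _ => tailEnergy_nonneg L _
      rw [div_lt_iff₀ (by positivity)]
      have : σ ^ 3 * CE * ∫ s in Icc (0 : ℝ) τ, tailEnergy L ((Φ N).flow s z) ≤
          c' * ∫ s in Icc (0 : ℝ) τ, tailEnergy L ((Φ N).flow s z) :=
        mul_le_mul_of_nonneg_right (by rw [hc'def]; linarith) hI
      nlinarith
    have hMarkov := measure_lt_setIntegral_flow_le (a₀ := fun _ => ab) (θ₀ := fun _ => θb)
      (u₀ := fun _ => ub) (Φ N) (measurable_tailEnergy L) (tailEnergy_nonneg L)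
      (fun z hz => integrableOn_tailEnergy_flow (Φ N) hz L τ) (by positivity : 0 ≤ η * δ / (4 * c' * τ))
      (by positivity : 0 < η / (2 * c')) (HE N ((le_max_right _ _).trans hN))
    refine ((measure_mono hincl).trans hMarkov).trans (le_of_eq ?_)
    congr 1
    field_simp
    ring
  calc P {z | η < |evenStat σ N (Φ N) τ χ g (fun _ => 1) r z -
          evenStat σ N (Φ N) τ χ g (fun q : V3 × V3 × V3 => speedCutoff L ‖q.2.2 - q.2.1‖) r z|}
      ≤ _ := main
    _ ≤ ENNReal.ofReal (δ / 2) + ENNReal.ofReal (δ / 2) := add_le_add hKev hEev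
    _ = ENNReal.ofReal δ := by rw [← ENNReal.ofReal_add (by positivity) (by positivity), add_halves]

end Summit.AtomisticToContinuum.HydrodynamicLimit.Theorems.CollisionRate

end
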